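import Summits.NavierStokesRegularity.NavierStokesRegularity.Theses.DirectionDissipationQuantum
import Summits.NavierStokesRegularity.NavierStokesRegularity.Theorems.ContinuousAlignmentContinuousAlignmentCriterionStubUnidirectionalLiouville
import HarnessLib

/-!
# Route DirectionDissipationQuantum, item `UnidirectionalAncientLiouville` (stmt-NavierStokesRegularity-1923)

The shared support item `UnidirectionalAncientLiouville` of route DirectionDissipationQuantum is,
verbatim, the stub `stub_unidirectionalLiouville` of the lines of crux `ContinuousAlignmentCriterion`
(route ContinuousAlignment), landed in
`Theorems/ContinuousAlignmentContinuousAlignmentCriterionStubUnidirectionalLiouville.lean`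
(p173853): a jointly smooth bounded ancient mild solution (`ν = 1`, duality form) whose vorticity is
everywhere parallel to one unit vector is spatially constant on every slice (Giga–Miura slice lemma,
rotation, planar descent, KNSS 2009 Thm 5.1). This file closes the item by that theorem.
-/

-- the summit and its single sub-problem share the name (CONVENTIONS §1), as in every Theorems file
set_option linter.dupNamespace false

namespace Summit.NavierStokesRegularity.NavierStokesRegularity.Theorems

/-- **`UnidirectionalAncientLiouville` holds** (item stmt-NavierStokesRegularity-1923 of route
DirectionDissipationQuantum): the route decl is definitionally the landed theorem
`stub_unidirectionalLiouville` (Giga–Miura 2011 Thm 1.1 / Giga–Gu–Hsu 2019 §2.4 made rate-free by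
KNSS 2009 Thm 5.1, `KNSS2009_liouville_planar_holds`). [folklore] -/
theorem unidirectionalAncientLiouville_proof :
    Summit.NavierStokesRegularity.NavierStokesRegularity.Theses.DirectionDissipationQuantum.UnidirectionalAncientLiouville := by
  unfold Summit.NavierStokesRegularity.NavierStokesRegularity.Theses.DirectionDissipationQuantum.UnidirectionalAncientLiouville
  exact stub_unidirectionalLiouville

end Summit.NavierStokesRegularity.NavierStokesRegularity.Theorems
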